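import Summits.CriticalPhenomena.CardyFormulaZ2.Theorems.CardySelfDualSegmentUniformBoxCrossingStubCoverPart1
import HarnessLib

/-!
# Stub `stub_cover` of line `Sketch` (crux stmt-CriticalPhenomena-5476 `UniformBoxCrossing`), part 2:
# the abstract order lemma, JOIN from meeting crossings, the reflected and translated frames

Bollobás–Riordan, *Percolation on self-dual polygon configurations* (2010, arXiv:1001.4674),
§5.1 (remark before Lemma 5.5, proof of Lemma 5.6), planar step, continued from
`…StubCoverPart1.lean` (the interface lemma) and concluded in `…StubCover.lean` (the stub):

* `forall_mem_region_of_mem`, `not_and_not_of_regions` — for regions of the strip with the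
  no-entry property of part 1: region membership is constant along a strip walk avoiding the
  interface, and two such regions whose interfaces are disjoint and lie in each other's region,
  one of them containing everything below some height, cover the strip (the column below a point
  outside both would enter them at a common interface vertex).
* `joinEvent_of_meet` — an open left–right crossing of `S₁ = [0,n]²` and one of
  `S₂ = [0,n] × [s, n+s]` with a common vertex witness `joinEvent n s`; hence a crossing of `S₁`
  without a vertex below `S₂` (or of `S₂` without a vertex above `S₁`) gives `JOIN`
  (Bollobás–Riordan's remark before Lemma 5.5).
* Frames: `H(S₁)` / `H(S₂)` for `ω` give `H([0,n]²)` for the reflected configurations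
  `reflConfig n 0 ω`, `reflConfig n s ω` and for the translate by `-(0,s)`; the interface walks of
  these frames map back to open crossings of `S₁`, `S₂` in `ω` (`reflWalk_facts`,
  `shiftWalk_facts`).
-/

noncomputable section

namespace Summit.CriticalPhenomena.CardyFormulaZ2.Cruxes.UniformBoxCrossing.NonSlantLine

open SimpleGraph Finset Literature.Probability.Percolation Literature.Probability.LatticeModels

/-! ### Regions with the no-entry property: two abstract lemmas -/

section Abstract

variable {n : ℕ}

/-- **Region membership is constant along a strip walk avoiding the interface.** If `R` can only
be entered (inside the strip `0 ≤ x₀ ≤ n`) through vertices of `S`, then along a walk in the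
strip avoiding `S`, membership in `R` does not change. [folklore] -/
theorem forall_mem_region_of_mem {R S : Set (Site 2)}
    (hne : ∀ ⦃a u : Site 2⦄, a ∈ R → u ∉ R → (zdGraph 2).Adj a u →
      0 ≤ a 0 → a 0 ≤ n → 0 ≤ u 0 → u 0 ≤ n → a ∈ S)
    (X : XWalk) (hX : ∀ z ∈ X.walk.support, 0 ≤ z 0 ∧ z 0 ≤ n)
    (hXS : ∀ z ∈ X.walk.support, z ∉ S) {q : Site 2} (hq : q ∈ X.walk.support) (hqR : q ∈ R) :
    ∀ z ∈ X.walk.support, z ∈ R := by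
  classical
  intro z hz
  by_contra hzR
  set p := (X.walk.takeUntil q hq).reverse.append (X.walk.takeUntil z hz) with hp
  have hsub : ∀ y ∈ p.support, y ∈ X.walk.support := by
    intro y hy
    rw [hp, Walk.support_append, List.mem_append, Walk.support_reverse, List.mem_reverse] at hy
    rcases hy with hy | hy
    · exact X.walk.support_takeUntil_subset_support hq hy
    · exact X.walk.support_takeUntil_subset_support hz (List.tail_subset _ hy)
  obtain ⟨d, hd, hd1, hd2⟩ := p.exists_boundary_dart R hqR hzR
  have h1 := hsub _ (p.dart_fst_mem_support_of_mem_darts hd)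
  have h2 := hsub _ (p.dart_snd_mem_support_of_mem_darts hd)
  exact hXS _ h1 (hne hd1 hd2 d.adj (hX _ h1).1 (hX _ h1).2 (hX _ h2).1 (hX _ h2).2)

/-- **The order lemma, abstract form.** Let `RP`, `RQ` be regions of the strip that can only be
entered through `SP`, `SQ` resp., with `RQ` containing everything below height `lo`,
`SP ⊆ RQ`, `SQ ⊆ RP` and `SP ∩ SQ = ∅`. Then every strip point lies in `RP ∪ RQ`: the column
below a point outside both regions enters `RP ∪ RQ` at a vertex which the no-entry property puts
in `SP ∩ SQ`. (Bollobás–Riordan: "`UH(S₁)` is strictly below `LH(S₂)`".)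
[cite: BollobasRiordan2010, §5.1 proof of Lemma 5.6] -/
theorem not_and_not_of_regions {lo : ℤ} {RP RQ SP SQ : Set (Site 2)}
    (hneP : ∀ ⦃a u : Site 2⦄, a ∈ RP → u ∉ RP → (zdGraph 2).Adj a u →
      0 ≤ a 0 → a 0 ≤ n → 0 ≤ u 0 → u 0 ≤ n → a ∈ SP)
    (hneQ : ∀ ⦃a u : Site 2⦄, a ∈ RQ → u ∉ RQ → (zdGraph 2).Adj a u →
      0 ≤ a 0 → a 0 ≤ n → 0 ≤ u 0 → u 0 ≤ n → a ∈ SQ)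
    (hlo : ∀ z : Site 2, z 1 < lo → z ∈ RQ)
    (hPQ : SP ⊆ RQ) (hQP : SQ ⊆ RP) (hdisj : ∀ z ∈ SP, z ∉ SQ)
    {v : Site 2} (hv0 : 0 ≤ v 0) (hv0' : v 0 ≤ n) (hvP : v ∉ RP) (hvQ : v ∉ RQ) : False := by
  have hv1 : lo ≤ v 1 := by
    by_contra h
    exact hvQ (hlo v (by omega))
  have hk : (((v 1 - lo + 1).toNat : ℕ) : ℤ) = v 1 - lo + 1 := Int.toNat_of_nonneg (by omega)
  obtain ⟨d, hd, hd1, hd2⟩ := (downRun v (v 1 - lo + 1).toNat).exists_boundary_dart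
    {z | z ∉ RP ∧ z ∉ RQ} ⟨hvP, hvQ⟩ (by
      simp only [Set.mem_setOf_eq, not_and_or, not_not]
      refine Or.inr (hlo _ ?_)
      rw [iterate_sub_single_apply_one]
      omega)
  have hu0 : d.fst 0 = v 0 :=
    (mem_support_downRun.1 ((downRun _ _).dart_fst_mem_support_of_mem_darts hd)).1
  have ha0 : d.snd 0 = v 0 :=
    (mem_support_downRun.1 ((downRun _ _).dart_snd_mem_support_of_mem_darts hd)).1
  have hadj : (zdGraph 2).Adj d.snd d.fst := d.adj.symm
  simp only [Set.mem_setOf_eq, not_and_or, not_not] at hd2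
  rcases hd2 with ha | ha
  · have h1 : d.snd ∈ SP := hneP ha hd1.1 hadj (by omega) (by omega) (by omega) (by omega)
    exact hdisj _ h1 (hneQ (hPQ h1) hd1.2 hadj (by omega) (by omega) (by omega) (by omega))
  · have h1 : d.snd ∈ SQ := hneQ ha hd1.2 hadj (by omega) (by omega) (by omega) (by omega)
    exact hdisj _ (hneP (hQP h1) hd1.1 hadj (by omega) (by omega) (by omega) (by omega)) h1

end Abstract

/-! ### JOIN from two meeting crossings -/

section Join

variable {n s : ℕ} {ω : BondConfig (Site 2)}

/-- **Meeting crossings give JOIN.** An open walk `P` in `S₁ = [0,n]²` from its left to its right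
side and an open walk `Q` in `S₂ = [0,n] × [s, n+s]` from its left to its right side with a
common vertex witness `joinEvent n s` (`a₁ → P → z → Q → a₂ + (0,s)` inside `S₁ ∪ S₂`).
[cite: BollobasRiordan2010, §5.1 remark before Lemma 5.5] -/
theorem joinEvent_of_meet (P Q : XWalk)
    (hP0 : P.fst 0 = 0) (hP1 : P.snd 0 = n)
    (hPS : ∀ z ∈ P.walk.support, 0 ≤ z 0 ∧ z 0 ≤ n ∧ 0 ≤ z 1 ∧ z 1 ≤ n)
    (hPω : ∀ e ∈ P.walk.edges, e ∈ ω)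
    (hQ0 : Q.fst 0 = 0) (hQ1 : Q.snd 0 = n)
    (hQS : ∀ z ∈ Q.walk.support, 0 ≤ z 0 ∧ z 0 ≤ n ∧ (s : ℤ) ≤ z 1 ∧ z 1 ≤ n + s)
    (hQω : ∀ e ∈ Q.walk.edges, e ∈ ω)
    {z : Site 2} (hzP : z ∈ P.walk.support) (hzQ : z ∈ Q.walk.support) : ω ∈ joinEvent n s := by
  classical
  have hv0 : (![0, (s : ℤ)] : Site 2) 0 = 0 := rfl
  have hv1 : (![0, (s : ℤ)] : Site 2) 1 = s := rfl
  have hPa := hPS _ P.walk.start_mem_support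
  have hPb := hPS _ P.walk.end_mem_support
  have hQa := hQS _ Q.walk.start_mem_support
  have hQb := hQS _ Q.walk.end_mem_support
  have hBig : ∀ y : Site 2, 0 ≤ y 0 ∧ y 0 ≤ n ∧ 0 ≤ y 1 ∧ y 1 ≤ n + s →
      y ∈ (↑(rectangle n (n + s)) : Set (Site 2)) := fun y h => by
    rw [Finset.mem_coe, mem_rectangle_iff]; push_cast; exact h
  refine ⟨P.fst, ?_, P.snd, ?_, Q.fst - ![0, (s : ℤ)], ?_, Q.snd - ![0, (s : ℤ)], ?_, ?_, ?_, ?_⟩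
  · simp only [leftSide, Finset.mem_filter, mem_rectangle_iff]; omega
  · simp only [rightSide, Finset.mem_filter, mem_rectangle_iff]; omega
  · simp only [leftSide, Finset.mem_filter, mem_rectangle_iff, Pi.sub_apply, hv0, hv1]; omega
  · simp only [rightSide, Finset.mem_filter, mem_rectangle_iff, Pi.sub_apply, hv0, hv1]; omega
  · exact mem_openConnIn_of_walk P.walk (fun y hy => by
      rw [Finset.mem_coe, mem_rectangle_iff]; exact hPS y hy) hPω
  · rw [sub_add_cancel, sub_add_cancel]
    exact mem_openConnIn_of_walk Q.walk (fun y hy => by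
      rw [mem_image_add_rectangle, hv0, hv1]; have := hQS y hy; omega) hQω
  · rw [sub_add_cancel]
    have c₁ : ω ∈ openConnIn ↑(rectangle n (n + s)) P.fst z :=
      mem_openConnIn_of_mem_support P.walk (fun y hy => hBig y (by have := hPS y hy; omega)) hPω hzP
    have c₂ : ω ∈ openConnIn ↑(rectangle n (n + s)) z Q.fst := by
      rw [openConnIn_comm]
      exact mem_openConnIn_of_mem_support Q.walk (fun y hy => hBig y (by have := hQS y hy; omega))
        hQω hzQ
    exact PlanarDuality.openConnIn_trans c₁ c₂

/-- An open left–right crossing of `S₁` has a vertex strictly below `S₂`, or it is a crossing of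
`S₂` as well and `JOIN` holds. [cite: BollobasRiordan2010, §5.1 remark before Lemma 5.5] -/
theorem exists_low_or_joinEvent (P : XWalk) (hP0 : P.fst 0 = 0) (hP1 : P.snd 0 = n)
    (hPS : ∀ z ∈ P.walk.support, 0 ≤ z 0 ∧ z 0 ≤ n ∧ 0 ≤ z 1 ∧ z 1 ≤ n)
    (hPω : ∀ e ∈ P.walk.edges, e ∈ ω) :
    (∃ z ∈ P.walk.support, z 1 < s) ∨ ω ∈ joinEvent n s := by
  by_cases h : ∃ z ∈ P.walk.support, z 1 < s
  · exact Or.inl h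
  · push Not at h
    exact Or.inr (joinEvent_of_meet P P hP0 hP1 hPS hPω hP0 hP1
      (fun z hz => by have := hPS z hz; have := h z hz; omega) hPω
      P.walk.start_mem_support P.walk.start_mem_support)

/-- An open left–right crossing of `S₂` has a vertex strictly above `S₁`, or it is a crossing of
`S₁` as well and `JOIN` holds. [cite: BollobasRiordan2010, §5.1 remark before Lemma 5.5] -/
theorem exists_high_or_joinEvent (Q : XWalk) (hQ0 : Q.fst 0 = 0) (hQ1 : Q.snd 0 = n)
    (hQS : ∀ z ∈ Q.walk.support, 0 ≤ z 0 ∧ z 0 ≤ n ∧ (s : ℤ) ≤ z 1 ∧ z 1 ≤ n + s)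
    (hQω : ∀ e ∈ Q.walk.edges, e ∈ ω) :
    (∃ z ∈ Q.walk.support, (n : ℤ) < z 1) ∨ ω ∈ joinEvent n s := by
  by_cases h : ∃ z ∈ Q.walk.support, (n : ℤ) < z 1
  · exact Or.inl h
  · push Not at h
    exact Or.inr (joinEvent_of_meet Q Q hQ0 hQ1
      (fun z hz => by have := hQS z hz; have := h z hz; omega) hQω hQ0 hQ1 hQS hQω
      Q.walk.start_mem_support Q.walk.start_mem_support)

end Join

/-! ### The reflected and translated frames -/

section Frames

variable {n s : ℕ} {ω : BondConfig (Site 2)}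

/-- Images under the reflection `upperRefl n s` (an involution). [folklore] -/
theorem mem_image_upperRefl_iff (X : Set (Site 2)) (z : Site 2) :
    z ∈ ⇑(upperRefl n s).toEquiv '' X ↔ upperRefl n s z ∈ X := by
  constructor
  · rintro ⟨y, hy, rfl⟩
    show upperRefl n s (upperRefl n s y) ∈ X
    rwa [upperRefl_upperRefl]
  · intro h
    exact ⟨upperRefl n s z, h, upperRefl_upperRefl n s z⟩

/-- The reflection is an involution on pairs. [folklore] -/
theorem map_upperRefl_map_upperRefl (e : Sym2 (Site 2)) :
    Sym2.map (upperRefl n s) (Sym2.map (upperRefl n s) e) = e := by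
  rw [Sym2.map_map]
  have : (⇑(upperRefl n s) ∘ ⇑(upperRefl n s) : Site 2 → Site 2) = id :=
    funext (upperRefl_upperRefl n s)
  rw [this, Sym2.map_id, id]

/-- The reflected configuration of a lattice configuration is a lattice configuration. [folklore] -/
theorem reflConfig_subset_edgeSet (hω : ω ⊆ (zdGraph 2).edgeSet) :
    reflConfig n s ω ⊆ (zdGraph 2).edgeSet := fun e he =>
  (sym2Equiv_mem_edgeSet_iff (upperRefl n s) e).1 (hω ((mem_reflConfig_iff n s ω e).1 he))

/-- `H(S₁)` for `ω` is `H(S₁)` for the configuration reflected in the axis of `S₁`. [folklore] -/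
theorem reflConfig_zero_mem_lrCrossing (h : ω ∈ lrCrossing n n) : reflConfig n 0 ω ∈ lrCrossing n n := by
  have h' := relabel_mem_openCrossing (upperRefl n 0).toEquiv h
  have hU : ⇑(upperRefl n 0).toEquiv '' (↑(rectangle n n) : Set (Site 2)) = ↑(rectangle n n) := by
    ext z
    simp only [mem_image_upperRefl_iff, Finset.mem_coe, mem_rectangle_iff, upperRefl_apply_zero,
      upperRefl_apply_one]
    push_cast
    omega
  have hA : ⇑(upperRefl n 0).toEquiv '' (↑(leftSide n n) : Set (Site 2)) = ↑(leftSide n n) := by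
    ext z
    simp only [mem_image_upperRefl_iff, Finset.mem_coe, leftSide, Finset.mem_filter, mem_rectangle_iff,
      upperRefl_apply_zero, upperRefl_apply_one]
    push_cast
    omega
  have hB : ⇑(upperRefl n 0).toEquiv '' (↑(rightSide n n) : Set (Site 2)) = ↑(rightSide n n) := by
    ext z
    simp only [mem_image_upperRefl_iff, Finset.mem_coe, rightSide, Finset.mem_filter, mem_rectangle_iff,
      upperRefl_apply_zero, upperRefl_apply_one]
    push_cast
    omega
  rw [hU, hA, hB] at h'
  exact h'

/-- `H(S₂)` for `ω` is `H(S₁)` for the configuration reflected in the line `x₁ = (n+s)/2`. [folklore] -/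
theorem reflConfig_mem_lrCrossing (h : ω ∈ upperLR n s) : reflConfig n s ω ∈ lrCrossing n n := by
  have h' := relabel_mem_openCrossing (upperRefl n s).toEquiv h
  have hU : ⇑(upperRefl n s).toEquiv '' upperSquare n s = ↑(rectangle n n) := by
    ext z
    rw [mem_image_upperRefl_iff, upperSquare, mem_image_add_rectangle, Finset.mem_coe, mem_rectangle_iff,
      upperRefl_apply_zero, upperRefl_apply_one]
    simp only [Matrix.cons_val_zero, Matrix.cons_val_one]
    omega
  have hA : ⇑(upperRefl n s).toEquiv '' ((· + ![0, (s : ℤ)]) '' ↑(leftSide n n)) = ↑(leftSide n n) := by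
    ext z
    simp only [mem_image_upperRefl_iff, Set.image_add_right, Set.mem_preimage, Finset.mem_coe, leftSide,
      Finset.mem_filter, mem_rectangle_iff, upperRefl_apply_zero, upperRefl_apply_one, Pi.add_apply,
      Pi.neg_apply, Matrix.cons_val_zero, Matrix.cons_val_one]
    omega
  have hB : ⇑(upperRefl n s).toEquiv '' ((· + ![0, (s : ℤ)]) '' ↑(rightSide n n)) = ↑(rightSide n n) := by
    ext z
    simp only [mem_image_upperRefl_iff, Set.image_add_right, Set.mem_preimage, Finset.mem_coe, rightSide,
      Finset.mem_filter, mem_rectangle_iff, upperRefl_apply_zero, upperRefl_apply_one, Pi.add_apply,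
      Pi.neg_apply, Matrix.cons_val_zero, Matrix.cons_val_one]
    omega
  rw [hU, hA, hB] at h'
  exact h'

/-- `H(S₂)` for `ω` is `H(S₁)` for the configuration translated by `-(0, s)`. [folklore] -/
theorem shiftConfig_mem_lrCrossing (h : ω ∈ upperLR n s) :
    BondConfig.relabel (sym2Equiv (Site.shift (-![0, (s : ℤ)]))) ω ∈ lrCrossing n n := by
  have h' := relabel_mem_openCrossing (Site.shift (-![0, (s : ℤ)])) h
  have key : ∀ X : Set (Site 2), ⇑(Site.shift (-![0, (s : ℤ)])) '' ((· + ![0, (s : ℤ)]) '' X) = X := by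
    intro X
    ext z
    simp only [Set.image_image, Set.mem_image, Site.shift_apply, add_neg_cancel_right, exists_eq_right]
  rw [upperSquare, key, key, key] at h'
  exact h'

/-- The translate of a lattice configuration is a lattice configuration. [folklore] -/
theorem shiftConfig_subset_edgeSet (hω : ω ⊆ (zdGraph 2).edgeSet) :
    BondConfig.relabel (sym2Equiv (Site.shift (-![0, (s : ℤ)]))) ω ⊆ (zdGraph 2).edgeSet := by
  intro e he
  have h := hω ((BondConfig.mem_relabel_iff _ ω e).1 he)
  have h2 := (sym2Equiv_mem_edgeSet_iff (zdShiftIso (-![0, (s : ℤ)])) _).2 h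
  rwa [show (zdShiftIso (-![0, (s : ℤ)])).toEquiv = Site.shift (-![0, (s : ℤ)]) from rfl,
    Equiv.apply_symm_apply] at h2

/-- The inverse translation on pairs. [folklore] -/
theorem sym2Equiv_shift_neg_symm_apply (v : Site 2) (e : Sym2 (Site 2)) :
    (sym2Equiv (Site.shift (-v))).symm e = e.map (· + v) := by
  rw [sym2Equiv_symm, sym2Equiv_apply]
  congr 1
  funext x
  simp [Site.shift_symm_apply, sub_neg_eq_add]

/-- Vertices of a reflected walk. [folklore] -/
theorem mem_support_map_upperRefl {w : XWalk} {z : Site 2} :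
    z ∈ (w.map (upperRefl n s)).walk.support ↔ upperRefl n s z ∈ w.walk.support := by
  simp only [XWalk.map, Walk.support_map, List.mem_map]
  constructor
  · rintro ⟨y, hy, rfl⟩
    simpa using hy
  · intro h
    exact ⟨upperRefl n s z, h, by simp⟩

/-- Edges of a reflected walk. [folklore] -/
theorem map_mem_edges_of_mem_edges_map {w : XWalk} {e : Sym2 (Site 2)}
    (he : e ∈ (w.map (upperRefl n s)).walk.edges) : e.map (upperRefl n s) ∈ w.walk.edges := by
  simp only [XWalk.map, Walk.edges_map, List.mem_map] at he
  obtain ⟨e₀, he₀, rfl⟩ := he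
  show Sym2.map (upperRefl n s) (Sym2.map (upperRefl n s) e₀) ∈ _
  rwa [map_upperRefl_map_upperRefl]

/-- **The reflected interface walk is an open crossing of the reflected square**: for a square
crossing `π` open in `reflConfig n s' ω`, the walk `upperRefl n s' ∘ π` runs in
`[0,n] × [s', n+s']` from its left to its right side and is open in `ω`. [folklore] -/
theorem reflWalk_facts (s' : ℕ) {π : XWalk} (hπ : IsSquareCrossing n π.walk)
    (hπω : ∀ e ∈ π.walk.edges, e ∈ reflConfig n s' ω) :
    (π.map (upperRefl n s')).fst 0 = 0 ∧ (π.map (upperRefl n s')).snd 0 = n ∧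
    (∀ z ∈ (π.map (upperRefl n s')).walk.support, 0 ≤ z 0 ∧ z 0 ≤ n ∧ (s' : ℤ) ≤ z 1 ∧ z 1 ≤ n + s') ∧
    (∀ e ∈ (π.map (upperRefl n s')).walk.edges, e ∈ ω) := by
  refine ⟨?_, ?_, ?_, ?_⟩
  · show upperRefl n s' π.fst 0 = 0
    rw [upperRefl_apply_zero, hπ.start]
  · show upperRefl n s' π.snd 0 = n
    rw [upperRefl_apply_zero, hπ.finish]
  · intro z hz
    have hb := squareCrossing_bounds hπ (mem_support_map_upperRefl.1 hz)
    rw [upperRefl_apply_zero, upperRefl_apply_one] at hb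
    omega
  · intro e he
    have h := (mem_reflConfig_iff n s' ω _).1 (hπω _ (map_mem_edges_of_mem_edges_map he))
    rwa [map_upperRefl_map_upperRefl] at h

/-- **The translated interface walk is an open crossing of `S₂`**: for a square crossing `π` open
in the configuration translated by `-(0,s)`, the walk `π + (0,s)` runs in `[0,n] × [s, n+s]`
from its left to its right side and is open in `ω`. [folklore] -/
theorem shiftWalk_facts {π : XWalk} (hπ : IsSquareCrossing n π.walk)
    (hπω : ∀ e ∈ π.walk.edges, e ∈ BondConfig.relabel (sym2Equiv (Site.shift (-![0, (s : ℤ)]))) ω) :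
    (π.shift ![0, (s : ℤ)]).fst 0 = 0 ∧ (π.shift ![0, (s : ℤ)]).snd 0 = n ∧
    (∀ z ∈ (π.shift ![0, (s : ℤ)]).walk.support, 0 ≤ z 0 ∧ z 0 ≤ n ∧ (s : ℤ) ≤ z 1 ∧ z 1 ≤ n + s) ∧
    (∀ e ∈ (π.shift ![0, (s : ℤ)]).walk.edges, e ∈ ω) := by
  have hv0 : (![0, (s : ℤ)] : Site 2) 0 = 0 := rfl
  have hv1 : (![0, (s : ℤ)] : Site 2) 1 = s := rfl
  refine ⟨?_, ?_, ?_, ?_⟩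
  · rw [XWalk.shift_fst, Pi.add_apply, hπ.start, hv0, add_zero]
  · rw [XWalk.shift_snd, Pi.add_apply, hπ.finish, hv0, add_zero]
  · intro z hz
    have hb := squareCrossing_bounds hπ (XWalk.mem_support_shift.1 hz)
    simp only [Pi.sub_apply, hv0, hv1] at hb
    omega
  · intro e he
    obtain ⟨e₀, he₀, rfl⟩ := XWalk.mem_edges_shift.1 he
    have h := (BondConfig.mem_relabel_iff _ ω e₀).1 (hπω e₀ he₀)
    rwa [sym2Equiv_shift_neg_symm_apply] at h

end Frames

/-! ### Registered glue -/

/-- Statement form of `not_and_not_of_regions` (the abstract order lemma): a registered glue step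
the LINE POSITS and proves right below (`coverOrder_holds`); not a literature fact, never to be
relocated. -/
def CoverOrderStatement : Prop :=
  ∀ (n : ℕ) (lo : ℤ) (RP RQ SP SQ : Set (Site 2)),
    (∀ ⦃a u : Site 2⦄, a ∈ RP → u ∉ RP → (zdGraph 2).Adj a u →
      0 ≤ a 0 → a 0 ≤ n → 0 ≤ u 0 → u 0 ≤ n → a ∈ SP) →
    (∀ ⦃a u : Site 2⦄, a ∈ RQ → u ∉ RQ → (zdGraph 2).Adj a u →
      0 ≤ a 0 → a 0 ≤ n → 0 ≤ u 0 → u 0 ≤ n → a ∈ SQ) →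
    (∀ z : Site 2, z 1 < lo → z ∈ RQ) → SP ⊆ RQ → SQ ⊆ RP → (∀ z ∈ SP, z ∉ SQ) →
    ∀ v : Site 2, 0 ≤ v 0 → v 0 ≤ n → v ∉ RP → v ∉ RQ → False

/-- The abstract order lemma, statement form. [cite: BollobasRiordan2010, §5.1 proof of Lemma 5.6] -/
theorem coverOrder_holds : CoverOrderStatement :=
  fun n _ _ _ _ _ hP hQ hlo hPQ hQP hd _ h0 h0' hvP hvQ =>
    not_and_not_of_regions (n := n) hP hQ hlo hPQ hQP hd h0 h0' hvP hvQ

end Summit.CriticalPhenomena.CardyFormulaZ2.Cruxes.UniformBoxCrossing.NonSlantLine
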